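import Summits.QuantumFields.YangMills.Theorems.BalabanUVNodesN21ChartRoadWindowVacuityOfGaugeInvariant
import Summits.QuantumFields.YangMills.Theorems.BalabanUVNodesN21ExpChartCoveringRadiusSharpHaar

/-!
# N21 (NE7c) · LOCATED-1's RADIUS DICHOTOMY: the un-fixed chart road's window letter at a block ⊇ star(z) forces the ZERO fibre ∕ cube law for EVERY
# radius `S < ρ_N = 2π·√(⌊N/2⌋⌈N/2⌉/N)` (every `N ≥ 1`; files 18∕21∕24: `S ≤ π` ∕ `S < √2·π`, `N ≥ 2`), and carries NO information for `S ≥ ρ_N`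
# (the window weight is then `≡ 1`: every fibre law with a density satisfies the letter)

Width seat pub-ymgap-dag-n21-w1 (g5; director-ym №197 ∕ HUMAN RULING D-0149), node N21 = NE7c (NOT PRINTED in [Bałaban 1983–89], NOT proved), lane K3⁸
`SpineGivenEndpointR13SepCoPHV` (stmt-QuantumFields-27366, KEY MAP v2; lineage K3⁷ 20544), `--kind proof --supports … --as helper`.  File 38 of the seat's chain — the
knit of file 21 (`…ChartRoadWindowVacuityOfGaugeInvariant`, p623160: dag-n21-w2's LOCATED-1 certificate p612378 in standard vocabulary) with files 32∕33 (`…CoveringRadiusSharp(Haar)`,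
p643952 ∕ p645369: `Haar (g·exp B̄_S) < 1 ⟺ S < ρ_N`).  THEOREMS ONLY: 0 `def`, 0 `sorry`; count-neutral.  NO Theses import.  Restates nothing; composes BY NAME.

THE POINT.  dag-n21-w2's certificate (junction №3's window letter `hlaw` + site invariance of the dressed density at a block holding a site star ⇒ the block fibre law
is ZERO) needs exactly one measure fact: the window about the star bond's centre is PROPER, `hq : Haar (expWindowSU (c b₀) S) < 1`.  File 18 discharged `hq` for `S ≤ π`
(`N ≥ 2`), file 24 for `S < √2·π`; file 33 says `hq` holds iff `S < ρ_N` — so the certificate holds for EVERY `S < ρ_N` and every `N ≥ 1` (§1–§2), and (§3) for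
`S ≥ ρ_N` the window is the whole group (file 32 `expWindowSU_eq_univ_of_coveringRadius_le`), the block window weight `windowSU b c S` is identically `1`, and the
letter `μ = (blockLaw b).withDensity (windowSU b c S · R)` is satisfied by EVERY measure with a density w.r.t. `blockLaw b` (with `R :=` that density): it forces
nothing.  LOCATED-1 therefore bites on EXACTLY the radii below the covering radius — the complete radius ledger of the un-fixed chart road.

WHAT IS PROVED ([bookkeeping] BY NAME; [folklore] for §3).
* §1 ★★′ `blockFibreLawOfDatum₉_eq_zero_of_window_of_siteInvariant_of_lt_coveringRadius` (p612378 ★★ with `hq := haar_expWindowSU_lt_one_of_lt_coveringRadius`) +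
  the (M1)-junk corollary `slotAntiConcentration_blockFibreLaw_of_window_of_siteInvariant_of_lt_coveringRadius`.
* §2 ★★″ `blockFibreLawOfDatum₉_eq_zero_of_window_of_gaugeInvariant_of_lt_coveringRadius` (file 21's route: `outBond_mem_filter_src` + `siteMove_invariant_of_gaugeInvariant`) +
  junk corollary + ★★‴ `cubeLawOfDatum₉_eq_zero_of_windows_of_gaugeInvariant_of_lt_coveringRadius` (per-fibre radii `S x < ρ_N`; file 21's Tonelli lemma).
* §3 `windowSU_eq_one_of_coveringRadius_le` (`ρ_N ≤ S ⇒ windowSU b c S y = 1`) · ★ `withDensity_eq_window_mul_of_coveringRadius_le` (`ρ_N ≤ S ⇒ (blockLaw b).withDensity R₀ =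
  (blockLaw b).withDensity (windowSU b c S · R₀)`: the letter is a tautology at and above the covering radius).

HONEST FRAMING.  An A6 statement about the chart road's OWN letters sharpened to its exact radius range, plus its converse tautology; the printed gauge invariance of the
dressed cube density stays a HYPOTHESIS (`GaugeField.GaugeInvariant`); the tree-gauge road (junction №5) is the live form and is untouched; nothing of Bałaban's asserted;
(M1) ∕ NE7c NOT PRINTED ∕ NOT proved; **N21 NOT discharged**; K3⁸ NOT claimed; counts unmoved (typed 28∕28 · discharged 5∕27); never a count claim; one finite 𝕋⁴ at fixed
ε — R4 would close only the conditional finite-𝕋⁴ rung `BalabanLadder.UV`, NOT the Yang–Mills mass gap (Clay); nothing about ℝ⁴ ∕ OS.  No decl below carries a cite tag.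
-/

set_option autoImplicit false

noncomputable section

open scoped BigOperators ENNReal
open MeasureTheory Set Function Finset

namespace Summit.QuantumFields.YangMills.Theorems.N21ChartRoadWindowVacuityBelowCoveringRadius

open Literature.MathematicalPhysics.QuantumFieldTheory.Balaban1983to89
open Literature.MathematicalPhysics.QuantumFieldTheory.Balaban1983to89.GaugeField (GaugeInvariant)
open Literature.MathematicalPhysics.QuantumFieldTheory.Balaban1983to89.T4Continuum
open Literature.MathematicalPhysics.QuantumFieldTheory.Balaban1983to89.Node00 hiding dimSU
open T4ShellMeasure (SlotAntiConcentration)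
open T4ShellMeasureDet (blockLaw)
open N21ShellSplitOfRecord13CoPH (cubeDensityOfDatum₉ blockFibreLawOfDatum₉ cubeLawOfDatum₉)
open N21ChartJunctionKeyed (blockFibreLawOfDatum₉_eq_zero_of_window_of_siteInvariant slotAntiConcentration_of_measure_eq_zero)
open N21ChartRoadWindowVacuityOfGaugeInvariant (outBond_mem_filter_src siteMove_invariant_of_gaugeInvariant cubeLawOfDatum₉_eq_zero_of_blockFibreLaws_eq_zero)
open N21ExpChartCoveringRadiusSharp (expWindowSU_eq_univ_of_coveringRadius_le)
open N21ExpChartCoveringRadiusSharpHaar (haar_expWindowSU_lt_one_of_lt_coveringRadius)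
open Summit.QuantumFields.BalabanUV.T4Continuum.ShellMeasureExpChartSUN (SUN)
open Summit.QuantumFields.BalabanUV.T4Continuum.ShellMeasureScalingSUN (expWindowSU windowSU)

/-! ## §1 dag-n21-w2's certificate with `hq` discharged for EVERY radius below the covering radius -/

section SiteInvariant

variable (F : T4Family) (N : ℕ) [NeZero N] (ϑ : Stage9Params F N) (Dt : FiniteEpsData F (SUN N)) (g₀ : ℕ → ℝ)
  (os : List (ULoop F)) (p : B12.RunParams) (g : ℕ → ℝ) (k : ℕ)

/-- ★★′ **THE WINDOW LETTER AND SITE INVARIANCE FORCE THE ZERO FIBRE LAW — FOR EVERY `S < ρ_N`, EVERY `N ≥ 1`.**  dag-n21-w2's ★★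
`blockFibreLawOfDatum₉_eq_zero_of_window_of_siteInvariant` (p612378) with its letter `hq` DISCHARGED by file 33's `haar_expWindowSU_lt_one_of_lt_coveringRadius`
(file 18: `S ≤ π`, `N ≥ 2`; file 24: `S < √2·π`). [bookkeeping] -/
theorem blockFibreLawOfDatum₉_eq_zero_of_window_of_siteInvariant_of_lt_coveringRadius
    (hU : LocalBgMeasurable F N ϑ.ν) (hζm : ZetaMeasurable F N ϑ.ζ) (hD : Dt.AvgMeasurable) (t : ℝ)
    (a : ↥(cubeIndices (F.P p.K) (cubeSide (F.P p.K).L ϑ.ν.M₂ (RkOfRecord (F.P p.K).L ϑ.ν.r (g k)) k)))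
    (b : Finset (PBond (F.P p.K) k)) (x : GaugeField (F.P p.K) k (SUN N))
    {S : ℝ} (hS : S < 2 * Real.pi * Real.sqrt (((N / 2 : ℕ) : ℝ) * ((N - N / 2 : ℕ) : ℝ) / N))
    (c : GaugeField (F.P p.K) k (SUN N)) (R : (↥b → SUN N) → ℝ≥0∞)
    (hlaw : blockFibreLawOfDatum₉ F N ϑ Dt g₀ os p g k t a b x = (blockLaw b).withDensity fun y => windowSU b c S y * R y)
    (O I : Finset ↥b) {b₀ : ↥b} (hb₀ : b₀ ∈ O)
    (hinv : ∀ (h : SUN N) (y : ↥b → SUN N), letI := Classical.decEq (PBond (F.P p.K) k)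
      cubeDensityOfDatum₉ F N ϑ Dt g₀ os p g k t a
          (Function.updateFinset x b fun i : ↥b =>
            (if i ∈ O then (fun u : SUN N => h * u) else if i ∈ I then (fun u : SUN N => u * h⁻¹) else id) (y i)) =
        cubeDensityOfDatum₉ F N ϑ Dt g₀ os p g k t a (Function.updateFinset x b y)) :
    blockFibreLawOfDatum₉ F N ϑ Dt g₀ os p g k t a b x = 0 :=
  blockFibreLawOfDatum₉_eq_zero_of_window_of_siteInvariant F N ϑ Dt g₀ os p g k hU hζm hD t a b x S c R hlaw O I hb₀ hinv
    (haar_expWindowSU_lt_one_of_lt_coveringRadius (c b₀) hS)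

/-- COROLLARY: under the same letters, (M1) for the block fibre law holds for EVERY statistic and EVERY `θ ρ D` — the junk instance of the ZERO law.
[bookkeeping] -/
theorem slotAntiConcentration_blockFibreLaw_of_window_of_siteInvariant_of_lt_coveringRadius
    (hU : LocalBgMeasurable F N ϑ.ν) (hζm : ZetaMeasurable F N ϑ.ζ) (hD : Dt.AvgMeasurable) (t : ℝ)
    (a : ↥(cubeIndices (F.P p.K) (cubeSide (F.P p.K).L ϑ.ν.M₂ (RkOfRecord (F.P p.K).L ϑ.ν.r (g k)) k)))
    (b : Finset (PBond (F.P p.K) k)) (x : GaugeField (F.P p.K) k (SUN N))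
    {S : ℝ} (hS : S < 2 * Real.pi * Real.sqrt (((N / 2 : ℕ) : ℝ) * ((N - N / 2 : ℕ) : ℝ) / N))
    (c : GaugeField (F.P p.K) k (SUN N)) (R : (↥b → SUN N) → ℝ≥0∞)
    (hlaw : blockFibreLawOfDatum₉ F N ϑ Dt g₀ os p g k t a b x = (blockLaw b).withDensity fun y => windowSU b c S y * R y)
    (O I : Finset ↥b) {b₀ : ↥b} (hb₀ : b₀ ∈ O)
    (hinv : ∀ (h : SUN N) (y : ↥b → SUN N), letI := Classical.decEq (PBond (F.P p.K) k)
      cubeDensityOfDatum₉ F N ϑ Dt g₀ os p g k t a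
          (Function.updateFinset x b fun i : ↥b =>
            (if i ∈ O then (fun u : SUN N => h * u) else if i ∈ I then (fun u : SUN N => u * h⁻¹) else id) (y i)) =
        cubeDensityOfDatum₉ F N ϑ Dt g₀ os p g k t a (Function.updateFinset x b y))
    (u : (↥b → SUN N) → ℝ) (θ ρ D : ℝ) :
    SlotAntiConcentration (blockFibreLawOfDatum₉ F N ϑ Dt g₀ os p g k t a b x) u θ ρ D :=
  slotAntiConcentration_of_measure_eq_zero
    (blockFibreLawOfDatum₉_eq_zero_of_window_of_siteInvariant_of_lt_coveringRadius F N ϑ Dt g₀ os p g k hU hζm hD t a b x hS c R hlaw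
      O I hb₀ hinv) u θ ρ D

end SiteInvariant

/-! ## §2 … with `hinv` from the standard `GaugeInvariant` of the dressed cube density, and the cube-law version -/

section GaugeInv

variable (F : T4Family) (N : ℕ) [NeZero N] (ϑ : Stage9Params F N) (Dt : FiniteEpsData F (SUN N)) (g₀ : ℕ → ℝ)
  (os : List (ULoop F)) (p : B12.RunParams) (g : ℕ → ℝ) (k : ℕ)

/-- ★★″ **THE WINDOW LETTER AND THE STANDARD GAUGE-INVARIANCE LETTER FORCE THE ZERO FIBRE LAW at a block containing a site star — FOR EVERY `S < ρ_N`,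
EVERY `N ≥ 1`** (file 21 ★★″: `S ≤ π`, `N ≥ 2`).  [bookkeeping] -/
theorem blockFibreLawOfDatum₉_eq_zero_of_window_of_gaugeInvariant_of_lt_coveringRadius
    (hU : LocalBgMeasurable F N ϑ.ν) (hζm : ZetaMeasurable F N ϑ.ζ) (hD : Dt.AvgMeasurable) (t : ℝ)
    (a : ↥(cubeIndices (F.P p.K) (cubeSide (F.P p.K).L ϑ.ν.M₂ (RkOfRecord (F.P p.K).L ϑ.ν.r (g k)) k)))
    (b : Finset (PBond (F.P p.K) k)) (x : GaugeField (F.P p.K) k (SUN N))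
    {S : ℝ} (hS : S < 2 * Real.pi * Real.sqrt (((N / 2 : ℕ) : ℝ) * ((N - N / 2 : ℕ) : ℝ) / N))
    (c : GaugeField (F.P p.K) k (SUN N)) (R : (↥b → SUN N) → ℝ≥0∞)
    (hlaw : blockFibreLawOfDatum₉ F N ϑ Dt g₀ os p g k t a b x = (blockLaw b).withDensity fun y => windowSU b c S y * R y)
    (z : Site (F.P p.K) k) (hstar : ∀ c' : PBond (F.P p.K) k, c'.src = z ∨ c'.tgt = z → c' ∈ b) (μ : Fin (F.P p.K).d)
    (hGI : GaugeInvariant (cubeDensityOfDatum₉ F N ϑ Dt g₀ os p g k t a)) :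
    blockFibreLawOfDatum₉ F N ϑ Dt g₀ os p g k t a b x = 0 :=
  blockFibreLawOfDatum₉_eq_zero_of_window_of_siteInvariant_of_lt_coveringRadius F N ϑ Dt g₀ os p g k hU hζm hD t a b x hS c R hlaw
    (univ.filter (fun i : ↥b => (i : PBond (F.P p.K) k).src = z)) (univ.filter (fun i : ↥b => (i : PBond (F.P p.K) k).tgt = z))
    (outBond_mem_filter_src b z hstar μ)
    (fun h y => siteMove_invariant_of_gaugeInvariant hGI b x z hstar h y)

/-- COROLLARY: under the same letters, (M1) for the block fibre law holds for EVERY statistic and EVERY `θ ρ D` — the junk instance of the ZERO law. [bookkeeping] -/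
theorem slotAntiConcentration_blockFibreLaw_of_window_of_gaugeInvariant_of_lt_coveringRadius
    (hU : LocalBgMeasurable F N ϑ.ν) (hζm : ZetaMeasurable F N ϑ.ζ) (hD : Dt.AvgMeasurable) (t : ℝ)
    (a : ↥(cubeIndices (F.P p.K) (cubeSide (F.P p.K).L ϑ.ν.M₂ (RkOfRecord (F.P p.K).L ϑ.ν.r (g k)) k)))
    (b : Finset (PBond (F.P p.K) k)) (x : GaugeField (F.P p.K) k (SUN N))
    {S : ℝ} (hS : S < 2 * Real.pi * Real.sqrt (((N / 2 : ℕ) : ℝ) * ((N - N / 2 : ℕ) : ℝ) / N))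
    (c : GaugeField (F.P p.K) k (SUN N)) (R : (↥b → SUN N) → ℝ≥0∞)
    (hlaw : blockFibreLawOfDatum₉ F N ϑ Dt g₀ os p g k t a b x = (blockLaw b).withDensity fun y => windowSU b c S y * R y)
    (z : Site (F.P p.K) k) (hstar : ∀ c' : PBond (F.P p.K) k, c'.src = z ∨ c'.tgt = z → c' ∈ b) (μ : Fin (F.P p.K).d)
    (hGI : GaugeInvariant (cubeDensityOfDatum₉ F N ϑ Dt g₀ os p g k t a))
    (u : (↥b → SUN N) → ℝ) (θ ρ D : ℝ) :
    SlotAntiConcentration (blockFibreLawOfDatum₉ F N ϑ Dt g₀ os p g k t a b x) u θ ρ D :=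
  slotAntiConcentration_of_measure_eq_zero
    (blockFibreLawOfDatum₉_eq_zero_of_window_of_gaugeInvariant_of_lt_coveringRadius F N ϑ Dt g₀ os p g k hU hζm hD t a b x hS c R hlaw
      z hstar μ hGI) u θ ρ D

/-- ★★‴ **THE WINDOW LETTER AT EVERY EXTERIOR FIELD + THE STANDARD GAUGE-INVARIANCE LETTER ⇒ THE TRUNCATED CUBE LAW IS ZERO** (block ⊇ star of a site,
per-fibre radii `S x < ρ_N`, every `N ≥ 1`; file 21 ★★‴: `S x ≤ π`, `N ≥ 2`). [bookkeeping] -/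
theorem cubeLawOfDatum₉_eq_zero_of_windows_of_gaugeInvariant_of_lt_coveringRadius
    (hU : LocalBgMeasurable F N ϑ.ν) (hζm : ZetaMeasurable F N ϑ.ζ) (hD : Dt.AvgMeasurable) (t : ℝ)
    (a : ↥(cubeIndices (F.P p.K) (cubeSide (F.P p.K).L ϑ.ν.M₂ (RkOfRecord (F.P p.K).L ϑ.ν.r (g k)) k)))
    (b : Finset (PBond (F.P p.K) k))
    (S : GaugeField (F.P p.K) k (SUN N) → ℝ) (hS : ∀ x, S x < 2 * Real.pi * Real.sqrt (((N / 2 : ℕ) : ℝ) * ((N - N / 2 : ℕ) : ℝ) / N))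
    (c : GaugeField (F.P p.K) k (SUN N) → GaugeField (F.P p.K) k (SUN N))
    (R : GaugeField (F.P p.K) k (SUN N) → (↥b → SUN N) → ℝ≥0∞)
    (hlaw : ∀ x, blockFibreLawOfDatum₉ F N ϑ Dt g₀ os p g k t a b x = (blockLaw b).withDensity fun y => windowSU b (c x) (S x) y * R x y)
    (z : Site (F.P p.K) k) (hstar : ∀ c' : PBond (F.P p.K) k, c'.src = z ∨ c'.tgt = z → c' ∈ b) (μ : Fin (F.P p.K).d)
    (hGI : GaugeInvariant (cubeDensityOfDatum₉ F N ϑ Dt g₀ os p g k t a)) :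
    cubeLawOfDatum₉ F N ϑ Dt g₀ os p g k t a = 0 :=
  cubeLawOfDatum₉_eq_zero_of_blockFibreLaws_eq_zero F N ϑ Dt g₀ os p g k hU hζm hD t a b fun x =>
    blockFibreLawOfDatum₉_eq_zero_of_window_of_gaugeInvariant_of_lt_coveringRadius F N ϑ Dt g₀ os p g k hU hζm hD t a b x (hS x) (c x) (R x)
      (hlaw x) z hstar μ hGI

end GaugeInv

/-! ## §3 … and for `S ≥ ρ_N` the window letter carries NO information: the window weight is `≡ 1` -/

section Above

variable {N : ℕ} {P : Params} {j : ℕ}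

/-- `ρ_N ≤ S ⇒ windowSU b c S y = 1` for every block `b`, centre field `c` and block configuration `y`: every one-bond window is the whole group
(file 32 `expWindowSU_eq_univ_of_coveringRadius_le`), so every indicator in the product is `1`. [folklore] -/
theorem windowSU_eq_one_of_coveringRadius_le (b : Finset (PBond P j)) (c : GaugeField P j (SUN N)) {S : ℝ}
    (hS : 2 * Real.pi * Real.sqrt (((N / 2 : ℕ) : ℝ) * ((N - N / 2 : ℕ) : ℝ) / N) ≤ S) (y : ↥b → SUN N) :
    windowSU b c S y = 1 := by
  unfold windowSU
  refine prod_eq_one fun i _ => ?_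
  rw [expWindowSU_eq_univ_of_coveringRadius_le (c i) hS, indicator_univ, Pi.one_apply]

/-- ★ **AT AND ABOVE THE COVERING RADIUS THE WINDOW LETTER IS A TAUTOLOGY**: if `ρ_N ≤ S`, EVERY measure with a density `R₀` w.r.t. `blockLaw b` satisfies
`μ = (blockLaw b).withDensity (windowSU b c S · R₀)` (take `R := R₀`) — in particular every block fibre law of the record, for every centre field `c`; so the
un-fixed chart road's LOCATED-1 bites on EXACTLY the radii `S < ρ_N` of §1–§2. [folklore] -/
theorem withDensity_eq_window_mul_of_coveringRadius_le [NeZero N] (b : Finset (PBond P j)) (c : GaugeField P j (SUN N)) {S : ℝ} (hS : 2 * Real.pi * Real.sqrt (((N / 2 : ℕ) : ℝ) * ((N - N / 2 : ℕ) : ℝ) / N) ≤ S)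
    (R₀ : (↥b → SUN N) → ℝ≥0∞) :
    (blockLaw b).withDensity R₀ = (blockLaw b).withDensity fun y => windowSU b c S y * R₀ y := by
  congr 1
  funext y
  rw [windowSU_eq_one_of_coveringRadius_le b c hS y, one_mul]

end Above

end Summit.QuantumFields.YangMills.Theorems.N21ChartRoadWindowVacuityBelowCoveringRadius

end
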